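import Summits.QuantumFields.YangMills.Theorems.BalabanUVNodesN07ChartLinFlatTwoAssembly
import Summits.QuantumFields.YangMills.Theorems.BalabanUVNodesN09DomAltThresholdNull
import Literature.MathematicalPhysics.QuantumFieldTheory.Balaban1983to89.B15Prop1ClassOpenAtRecord
import HarnessLib

/-!
# N07 at the record — THE REGULARITY-CLASS CONJUNCT OF THE KNIT TOKEN (rng) FOR THE FRAME-FREE (47)-CARRYING CHART: `𝔖♭.chartCfgLin T♭ V ∈ bgReg F N K k ε`
# IN THE SMALL whenever the background itself lies in the (open) class, and (rng) IN FULL at the fixed point for `N = 2`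

Cell `pub-ymgap`, seat `pub-ymgap-dag-n07-w3` (g28, WIDTH SEAT 3 on N07 [B11]); helper file keyed `--supports stmt-QuantumFields-27238 --as helper` (K0ᴬ road);
count-neutral.  INTENT-20 of the seat.  The K0ᴬ road's (rng) reads `∀ V ∈ S.dom, ∀ A ∈ Kc V, S.chart V A ∈ bgReg … ∧ Averaging.iter … (S.chart V A) = V`; files 13–19 of the
seat made the AVERAGE conjunct a theorem for the (47)-carrying chart; this file does the same for the REGULARITY-CLASS conjunct, by openness: `bgReg F N K k ε =
{U | PlaqSmall (ε η_k²) U}` is OPEN (dag-n09's ✓`isOpen_setOf_plaqSmall_SU`), eventual statements pull back to the matrix topology (dag-n12's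
✓`eventually_coeField_of_eventually`), and the chart field tends to `↑U₀` (✓`tendsto_chartFieldFlat_zero`).

## What is here

* §1 ★ `eventually_mem_bgReg_nhds_coe` — `U₀ ∈ bgReg F N K k ε` ⟹ near `↑U₀` every `SU(N)` configuration lies in `bgReg F N K k ε`.
* §1 ★★ `exists_radius_bgRegFlat` — one `ρ > 0` (`ρ ≤ a_C`; background + Sect. C data + `ε`) with: `‖A′‖ < ρ` ⟹ every `SU(N)` configuration carrying the frame-free chart
  field at `A′` lies in `bgReg F N K k ε`.
* §2 ★★★ `exists_radius_chartCfgLinFlat_mem_bgReg` — at the fixed point: for every scheme regime with `ε₄ + a𝔄 ≤ ρ`, `‖J‖ ≤ j`, `‖𝔄♭V‖ < a𝔄` and the `SU`-exponent row,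
  `𝔖♭.chartCfgLin T♭ V ∈ bgReg F N K k ε` (any `N`).
* §3 ★★★★★ `exists_knitRng_chartCfgLinFlat_two_smallRadii` — `N = 2`, THE KNIT TOKEN (rng) IN FULL for `Kc V := {𝒜♭(V)}` at the (47)-carrying chart: `∃ t₀ > 0, ∀ 0 < ε_C ≤ t₀,
  ∃ ρ > 0, ∀ data ∕ parameters, ε₄ + a𝔄 ≤ ρ → a₃ ≤ ε_C → (data rows) → Regime → ‖J‖ ≤ j → FrakGSliceTok → ∀ V, (20)-smallness ≤ 1∕4 → ‖𝔄♭V‖ < a𝔄 →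
  𝔖♭.chartCfgLin T♭ V ∈ bgReg F 2 K k ε ∧ Averaging.iter (avOfRecord F 2 K) k (𝔖♭.chartCfgLin T♭ V) = V` — given only that the background is in the class (`U₀ ∈ bgReg F 2 K k ε`)
  and guarded below `k`; displayed = g27's standard row list for the (47)-free chart.

## Honest labels

Openness ∕ continuity bookkeeping on landed letters; `U₀ ∈ bgReg` is a HYPOTHESIS (print: the background is itself (1.2)-regular with margin — an estimate of [15] Thm 1 not
typed here); nothing of Bałaban's estimates; K0ᴬ ⟨27238⟩ NOT closed; N07 NOT discharged; R4 is the conditional finite-𝕋⁴ rung `BalabanLadder.UV` only; finite torus at fixed `ε`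
— nothing continuum ∕ OS ∕ Clay.  **The Yang–Mills mass gap is NOT proved by any of this.**  No `sorry`, no `def`, no `instance ∕ notation`; standard axioms.
[cite: Balaban1987RG1, (0.18) p.255, (1.2) p.260, (0.21) p.256; Balaban1985Variational, (7) p.279, (15) p.280, (20) p.281, (47) p.285, Prop. 6 p.295]
-/

set_option autoImplicit false

noncomputable section

open scoped Matrix Matrix.Norms.L2Operator InnerProductSpace Topology

namespace Summit.QuantumFields.YangMills.Theorems.N07ChartLinFlatBgReg

open Filter Metric
open Literature.MathematicalPhysics.QuantumFieldTheory.Balaban1983to89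
open Literature.MathematicalPhysics.QuantumFieldTheory.Balaban1983to89.T4Continuum (T4Family)
open Literature.MathematicalPhysics.QuantumFieldTheory.Balaban1983to89.Node00
open B15AveragingHolomorphic (iterMh)
open B15Prop1ClassOpenAtRecord (eventually_coeField_of_eventually)
open B9Eq311TracePairing (starW)
open B11Eq103H1Complex (SiteL2K BondL2K)
open B11Eq111FrakG (nabla115)
open B11Eq115Space (NegSize NegSup JetSup)
open B11Eq174Chart (Regime)
open B11Prop6Scheme (Prop4Hyp)
open B11Eq90V0GroupComposed (T47)
open Summit.QuantumFields.YangMills.BalabanUVNodes.N09DomAltThresholdNull (isOpen_setOf_plaqSmall_SU)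
open Summit.QuantumFields.YangMills.Theorems.N07TraceSectorDefs (scalPartW)
open Summit.QuantumFields.YangMills.Theorems.N07ChartLinAverageFlat (coeField_chartLinFlat_eq_expOver tendsto_chartFieldFlat_zero)
open Summit.QuantumFields.YangMills.Theorems.N07LieTokAtOfRecordTwo (lieTokAt_bgSchemeOfRecord_two)
open Summit.QuantumFields.YangMills.Theorems.N07ChartLinFlatLieTok (realRows_of_lieTokAt expoLinAt_sol_memFlat_of_rows)
open Summit.QuantumFields.YangMills.Theorems.N07ChartLinFlatTwoAssembly (exists_iter_chartCfgLinFlat_eq_two_smallRadii)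
open Summit.QuantumFields.YangMills.Theorems.N07SectCRegimeOfRecordSmall (exists_sectCRegime_ofRecord)
open Summit.QuantumFields.YangMills.Theorems.N07SchemeTokOfRecordTwoSmall (exists_radius_cslRows)

section Record

variable (F : T4Family) (N : ℕ) [NeZero N] (K : ℕ) (k : ℕ) (Ω : ℕ → Set (Site (F.P K) 0)) (U₀ : GaugeField (F.P K) 0 (SU N))
  [Fact (0 < (F.L : ℝ))] [Fact (0 < (F.P K).eta k)] [Fact (0 < c0Rec F K k)] [Fact (∀ c, 0 < wBRec F K k c)]
  (levB : PBond (F.P K) k → ℕ) (a : ℝ)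
  (hposb : ∀ x, x ≠ 0 → 0 < RCLike.re ⟪x, laplaceAOfRecord F N k U₀ (QOfRecord F N k U₀) (QflatOfRecord F N k) a x⟫_ℂ)
  (hQ : Function.Surjective (QOfRecord F N k U₀))

/-! ## §1  The class near the background, and along the chart field -/

omit [Fact (0 < (F.L : ℝ))] [Fact (0 < (F.P K).eta k)] [Fact (0 < c0Rec F K k)] [Fact (∀ c, 0 < wBRec F K k c)] in
/-- ★ **NEAR A BACKGROUND IN THE CLASS, EVERY CONFIGURATION IS IN THE CLASS** (read on the matrix fields): `bgReg F N K k ε` is open (✓`isOpen_setOf_plaqSmall_SU`) and eventual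
statements pull back along `coeField` (✓`eventually_coeField_of_eventually`). [cite: Balaban1987RG1, (0.18) p.255, (1.2) p.260] -/
theorem eventually_mem_bgReg_nhds_coe {ε : ℝ} (hU₀ : U₀ ∈ bgReg F N K k ε) :
    ∀ᶠ Q in 𝓝 (coeField U₀), ∀ U : GaugeField (F.P K) 0 (SU N), coeField U = Q → U ∈ bgReg F N K k ε :=
  eventually_coeField_of_eventually ((isOpen_setOf_plaqSmall_SU N (F.P K) 0 (ε * (F.P K).eta k ^ 2)).mem_nhds hU₀)

/-- ★★ **ONE RADIUS FOR THE CLASS ALONG THE FRAME-FREE CHART FIELD**: `ρ > 0`, `ρ ≤ a_C`, with `‖A′‖ < ρ` ⟹ every `SU(N)` configuration whose matrices are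
`expOver U₀ (η • evLit (T47 H₁♭ C^{sl} ε_C A′))` lies in `bgReg F N K k ε`. [cite: Balaban1987RG1, (1.2) p.260; Balaban1985Variational, (15) p.280, (47) p.285, Prop. 3 p.289] -/
theorem exists_radius_bgRegFlat {ε : ℝ} (hU₀ : U₀ ∈ bgReg F N K k ε) {b C₂ c₄ aC εC : ℝ}
    (RC : Regime (H1OfRecordAtBgFlat F N K k Ω U₀ levB a hposb hQ) (0 : Space115Lit F N K k Ω U₀ →L[ℂ] Space115Lit F N K k Ω U₀)
      (CslOfRecord F N K k Ω U₀ levB) b 0 C₂ c₄ 0 aC εC)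
    (hC : Prop4Hyp (CslOfRecord F N K k Ω U₀ levB) C₂ c₄) (haC : 0 < aC) :
    ∃ ρ : ℝ, 0 < ρ ∧ ρ ≤ aC ∧ ∀ A' : Space115Lit F N K k Ω U₀, ‖A'‖ < ρ →
      ∀ U : GaugeField (F.P K) 0 (SU N), coeField U = expOver U₀ ((((F.P K).eta k : ℝ) : ℂ) • evLit F N K k Ω U₀
          (T47 (H1OfRecordAtBgFlat F N K k Ω U₀ levB a hposb hQ) (CslOfRecord F N K k Ω U₀ levB) εC A')) → U ∈ bgReg F N K k ε := by
  have h := (tendsto_chartFieldFlat_zero F N K k Ω U₀ levB a hposb hQ RC hC haC).eventually (eventually_mem_bgReg_nhds_coe F N K k U₀ hU₀)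
  obtain ⟨δ, hδ, hball⟩ := Metric.eventually_nhds_iff.1 h
  refine ⟨min δ aC, lt_min hδ haC, min_le_right _ _, fun A' hA' => ?_⟩
  exact hball (by rw [dist_zero_right]; exact lt_of_lt_of_le hA' (min_le_left _ _))

/-! ## §2  At the fixed point of the un-framed scheme (any `N`) -/

variable (Gp : SiteL2K ℂ (F.P K).d (fun _ => (F.P K).sitesPerDir 0) (c0Rec F K k) (WRec N) →ₗ[ℂ]
    SiteL2K ℂ (F.P K).d (fun _ => (F.P K).sitesPerDir 0) (c0Rec F K k) (WRec N))
  (Δ2 : BondL2K ℂ (F.P K).d (fun _ => (F.P K).sitesPerDir 0) (c0Rec F K k) (WRec N) →ₗ[ℂ]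
    BondL2K ℂ (F.P K).d (fun _ => (F.P K).sitesPerDir 0) (c0Rec F K k) (WRec N))
  (hposπ : ∀ x, x ≠ 0 → 0 < RCLike.re ⟪x, laplaceAOfRecordAt F N k U₀ (hessOpOfRecord128 F N k U₀ Gp (QflatOfRecord F N k) Δ2)
    (QOfRecord F N k U₀) (QflatOfRecord F N k) a x⟫_ℂ)

/-- ★★★ **THE REGULARITY-CLASS CONJUNCT OF (rng) AT THE FIXED POINT, IN THE SMALL** (any `N`): one `ρ > 0` such that for every scheme regime with `ε₄ + a𝔄 ≤ ρ`, `‖J‖ ≤ j`,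
`‖𝔄♭V‖ < a𝔄` and the `SU`-exponent row, `𝔖♭.chartCfgLin T♭ V ∈ bgReg F N K k ε`. [cite: Balaban1987RG1, (1.2) p.260; Balaban1985Variational, (15) p.280, Prop. 6 (115)–(116) p.295] -/
theorem exists_radius_chartCfgLinFlat_mem_bgReg (dom : Set (GaugeField (F.P K) k (SU N))) {ε : ℝ} (hU₀ : U₀ ∈ bgReg F N K k ε) {b C₂ c₄ aC εC : ℝ}
    (RC : Regime (H1OfRecordAtBgFlat F N K k Ω U₀ levB a hposb hQ) (0 : Space115Lit F N K k Ω U₀ →L[ℂ] Space115Lit F N K k Ω U₀)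
      (CslOfRecord F N K k Ω U₀ levB) b 0 C₂ c₄ 0 aC εC)
    (hC : Prop4Hyp (CslOfRecord F N K k Ω U₀ levB) C₂ c₄) (haC : 0 < aC) :
    ∃ ρ : ℝ, 0 < ρ ∧ ρ ≤ aC ∧ ∀ (B₀ C₄ a₃ j a𝔄 ε₄ : ℝ), ε₄ + a𝔄 ≤ ρ →
      Regime (frakGOfRecordAtBg128 F N K k Ω U₀ Gp Δ2 a hposπ hQ) (0 : Space115Lit F N K k Ω U₀ →L[ℂ] Space115Lit F N K k Ω U₀)
        (WOfRecordAt F N K k Ω U₀ levB a hposb hQ εC Gp) B₀ 0 C₄ a₃ j a𝔄 ε₄ →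
      ‖JOfRecordAtBg F N K k Ω U₀‖ ≤ j →
      ∀ {V : GaugeField (F.P K) k (SU N)}, ‖frakAOfRecordAtBg128 F N K k Ω U₀ levB Gp Δ2 a hposπ hQ V‖ < a𝔄 →
      (∀ b', (bgSchemeOfRecord F N K k Ω U₀ dom levB Gp Δ2 a hposπ hposb hQ εC B₀ C₄ a₃ j a𝔄 ε₄).expoLinAt
        (fun _ => T47 (H1OfRecordAtBgFlat F N K k Ω U₀ levB a hposb hQ) (CslOfRecord F N K k Ω U₀ levB) εC) V
          ((bgSchemeOfRecord F N K k Ω U₀ dom levB Gp Δ2 a hposπ hposb hQ εC B₀ C₄ a₃ j a𝔄 ε₄).sol V) b' ∈ Matrix.specialUnitaryGroup (Fin N) ℂ) →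
      (bgSchemeOfRecord F N K k Ω U₀ dom levB Gp Δ2 a hposπ hposb hQ εC B₀ C₄ a₃ j a𝔄 ε₄).chartCfgLin
        (fun _ => T47 (H1OfRecordAtBgFlat F N K k Ω U₀ levB a hposb hQ) (CslOfRecord F N K k Ω U₀ levB) εC) V ∈ bgReg F N K k ε := by
  obtain ⟨ρ, hρ, hρaC, hrows⟩ := exists_radius_bgRegFlat F N K k Ω U₀ levB a hposb hQ hU₀ RC hC haC
  refine ⟨ρ, hρ, hρaC, fun B₀ C₄ a₃ j a𝔄 ε₄ hfit R hJ V h𝔄 hSU => ?_⟩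
  have hsol := (bgSchemeOfRecord_sol_spec F N K k Ω U₀ levB Gp Δ2 a hposπ hposb hQ dom R hJ h𝔄).1
  have hA : ‖(bgSchemeOfRecord F N K k Ω U₀ dom levB Gp Δ2 a hposπ hposb hQ εC B₀ C₄ a₃ j a𝔄 ε₄).sol V +
      frakAOfRecordAtBg128 F N K k Ω U₀ levB Gp Δ2 a hposπ hQ V‖ < ρ :=
    lt_of_lt_of_le (lt_of_le_of_lt (norm_add_le _ _) (by linarith)) hfit
  have hcoe := coeField_chartLinFlat_eq_expOver F N K k Ω U₀ levB a hposb hQ Gp Δ2 hposπ dom V _ hSU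
  rw [BgScheme.chartLin_sol] at hcoe
  exact hrows _ hA _ hcoe

/-! ## §3  `N = 2`: the KNIT token (rng) in full for the singleton family at the (47)-carrying chart -/

end Record

section Two

variable (F : T4Family) {K : ℕ} (k : ℕ) (Ω : ℕ → Set (Site (F.P K) 0)) (U₀ : GaugeField (F.P K) 0 (SU 2))
  [Fact (0 < (F.L : ℝ))] [Fact (0 < (F.P K).eta k)] (levB : PBond (F.P K) k → ℕ) [Fact (0 < c0Rec F K k)] [Fact (∀ c, 0 < wBRec F K k c)] (a : ℝ)
  (hposb : ∀ x, x ≠ 0 → 0 < RCLike.re ⟪x, laplaceAOfRecord F 2 k U₀ (QOfRecord F 2 k U₀) (QflatOfRecord F 2 k) a x⟫_ℂ)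
  (hQ : Function.Surjective (QOfRecord F 2 k U₀))

/-- ★★★★★ **THE KNIT TOKEN (rng) IN FULL — class conjunct AND average conjunct — for `Kc V := {𝒜♭(V)}` at the frame-free (47)-carrying chart, `N = 2`**: see the module
docstring, §3.  Displayed: `U₀ ∈ bgReg F 2 K k ε` and guarded below `k`; g27's standard row list for the (47)-free chart; the radii orderings.
[cite: Balaban1987RG1, (0.21) p.256, (1.2) p.260; Balaban1985Variational, (7) p.279, (15) p.280, (20) p.281, (47) p.285, Prop. 6 (115)–(121) p.295] -/
theorem exists_knitRng_chartCfgLinFlat_two_smallRadii (h : SmallBelow (avOfRecord F 2 K) k U₀) {ε : ℝ} (hU₀ : U₀ ∈ bgReg F 2 K k ε) :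
    ∃ t₀ > 0, ∀ εC : ℝ, 0 < εC → εC ≤ t₀ → ∃ ρ : ℝ, 0 < ρ ∧ ∀ (dom : Set (GaugeField (F.P K) k (SU 2)))
      (Gp : SiteL2K ℂ (F.P K).d (fun _ => (F.P K).sitesPerDir 0) (c0Rec F K k) (WRec 2) →ₗ[ℂ]
        SiteL2K ℂ (F.P K).d (fun _ => (F.P K).sitesPerDir 0) (c0Rec F K k) (WRec 2))
      (Δ2 : BondL2K ℂ (F.P K).d (fun _ => (F.P K).sitesPerDir 0) (c0Rec F K k) (WRec 2) →ₗ[ℂ]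
        BondL2K ℂ (F.P K).d (fun _ => (F.P K).sitesPerDir 0) (c0Rec F K k) (WRec 2))
      (hposπ : ∀ x, x ≠ 0 → 0 < RCLike.re ⟪x, laplaceAOfRecordAt F 2 k U₀ (hessOpOfRecord128 F 2 k U₀ Gp (QflatOfRecord F 2 k) Δ2)
        (QOfRecord F 2 k U₀) (QflatOfRecord F 2 k) a x⟫_ℂ) (B₀ C₄ a₃ j a𝔄 ε₄ : ℝ), ε₄ + a𝔄 ≤ ρ → a₃ ≤ εC →
      (∀ s, Gp (starW (phiRec 2) s) = starW (phiRec 2) (Gp s)) → (∀ s, Gp (scalPartW 2 _ s) = scalPartW 2 _ (Gp s)) →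
      (∀ x, Δ2 (starW (phiRec 2) x) = starW (phiRec 2) (Δ2 x)) → (∀ x, Δ2 (scalPartW 2 _ x) = scalPartW 2 _ (Δ2 x)) →
      Regime (frakGOfRecordAtBg128 F 2 K k Ω U₀ Gp Δ2 a hposπ hQ) (0 : Space115Lit F 2 K k Ω U₀ →L[ℂ] Space115Lit F 2 K k Ω U₀)
        (WOfRecordAt F 2 K k Ω U₀ levB a hposb hQ εC Gp) B₀ 0 C₄ a₃ j a𝔄 ε₄ →
      ‖JOfRecordAtBg F 2 K k Ω U₀‖ ≤ j → FrakGSliceTok F 2 K k Ω U₀ Gp Δ2 a hposπ hQ →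
      ∀ {V : GaugeField (F.P K) k (SU 2)},
      (∀ c, ‖(V c : Matrix (Fin 2) (Fin 2) ℂ) * star (Averaging.iter (avOfRecord F 2 K) k U₀ c : Matrix (Fin 2) (Fin 2) ℂ) - 1‖ ≤ 1 / 4) →
      ‖frakAOfRecordAtBg128 F 2 K k Ω U₀ levB Gp Δ2 a hposπ hQ V‖ < a𝔄 →
      (bgSchemeOfRecord F 2 K k Ω U₀ dom levB Gp Δ2 a hposπ hposb hQ εC B₀ C₄ a₃ j a𝔄 ε₄).chartCfgLin
          (fun _ => T47 (H1OfRecordAtBgFlat F 2 K k Ω U₀ levB a hposb hQ) (CslOfRecord F 2 K k Ω U₀ levB) εC) V ∈ bgReg F 2 K k ε ∧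
        Averaging.iter (avOfRecord F 2 K) k ((bgSchemeOfRecord F 2 K k Ω U₀ dom levB Gp Δ2 a hposπ hposb hQ εC B₀ C₄ a₃ j a𝔄 ε₄).chartCfgLin
          (fun _ => T47 (H1OfRecordAtBgFlat F 2 K k Ω U₀ levB a hposb hQ) (CslOfRecord F 2 K k Ω U₀ levB) εC) V) = V := by
  -- the average conjunct's thresholds
  obtain ⟨t₁, ht₁, havg⟩ := exists_iter_chartCfgLinFlat_eq_two_smallRadii F k Ω U₀ levB a hposb hQ h
  -- Sect. C data for the class conjunct (its own regime, any small radius) and the `C^{sl}` rows for the `SU`-exponent row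
  obtain ⟨b, C₂, c₄, t₂, -, -, -, ht₂, hP, hReg⟩ := exists_sectCRegime_ofRecord F 2 K k Ω U₀ levB a hposb hQ h
  obtain ⟨r, hr, hcsl⟩ := exists_radius_cslRows F 2 K k Ω U₀ levB h
  refine ⟨min t₁ (min t₂ (r / 3)), lt_min ht₁ (lt_min ht₂ (by positivity)), fun εC hε hεt => ?_⟩
  have hεt₁ : εC ≤ t₁ := hεt.trans (min_le_left _ _)
  have hεt₂ : εC ≤ t₂ := (hεt.trans (min_le_right _ _)).trans (min_le_left _ _)
  have hεr : εC + εC < r := by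
    have := (hεt.trans (min_le_right _ _)).trans (min_le_right _ _)
    linarith
  obtain ⟨ρ₁, hρ₁, havg₁⟩ := havg εC hε hεt₁
  have RC : Regime (H1OfRecordAtBgFlat F 2 K k Ω U₀ levB a hposb hQ) 0 (CslOfRecord F 2 K k Ω U₀ levB) b 0 C₂ c₄ 0 εC εC :=
    hReg εC εC hε le_rfl hεt₂
  have hCreal : ∀ A : Space115Lit F 2 K k Ω U₀,
      ((JetSup.equiv _ _ (nabla115 ((F.P K).eta k) (unitsOfRecord F 2 U₀))).symm
          (star (JetSup.equiv _ _ (nabla115 ((F.P K).eta k) (unitsOfRecord F 2 U₀)) A)) : Space115Lit F 2 K k Ω U₀) = A →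
      ‖A‖ ≤ εC + εC → ((NegSup.equiv _ _).symm (star (NegSup.equiv _ _ (CslOfRecord F 2 K k Ω U₀ levB A))) :
        NegSize (F.L : ℝ) ((F.P K).eta k) levB 0 (Matrix (Fin 2) (Fin 2) ℂ)) = CslOfRecord F 2 K k Ω U₀ levB A :=
    fun A hAh hAn => (hcsl A (lt_of_le_of_lt hAn hεr) hAh).1
  have hCtr : ∀ A : Space115Lit F 2 K k Ω U₀,
      ((JetSup.equiv _ _ (nabla115 ((F.P K).eta k) (unitsOfRecord F 2 U₀))).symm
          (star (JetSup.equiv _ _ (nabla115 ((F.P K).eta k) (unitsOfRecord F 2 U₀)) A)) : Space115Lit F 2 K k Ω U₀) = A →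
      (∀ b', (JetSup.equiv _ _ (nabla115 ((F.P K).eta k) (unitsOfRecord F 2 U₀)) A b').trace = 0) →
      ‖A‖ ≤ εC + εC → ∀ c, (NegSup.equiv _ _ (CslOfRecord F 2 K k Ω U₀ levB A) c).trace = 0 :=
    fun A hAh _ hAn => (hcsl A (lt_of_le_of_lt hAn hεr) hAh).2
  obtain ⟨ρ₂, hρ₂, hρ₂aC, hcls⟩ := exists_radius_bgRegFlat F 2 K k Ω U₀ levB a hposb hQ hU₀ RC hP hε
  refine ⟨min ρ₁ ρ₂, lt_min hρ₁ hρ₂, fun dom Gp Δ2 hposπ B₀ C₄ a₃ j a𝔄 ε₄ hfit ha₃ hGpR hGpS hΔ2R hΔ2S R hJ h𝔊 V hV h𝔄 => ⟨?_, ?_⟩⟩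
  · -- the class conjunct
    have hL := lieTokAt_bgSchemeOfRecord_two F K k Ω U₀ dom levB a hposπ hposb hQ εC B₀ C₄ a₃ j a𝔄 ε₄ RC hCreal hCtr h hGpR hGpS hΔ2R hΔ2S hP ha₃
      R hJ h𝔄 hV
    obtain ⟨hA'herm, hA'tr⟩ := realRows_of_lieTokAt F k Ω U₀ levB a hposb hQ Gp Δ2 hposπ dom B₀ C₄ a₃ j a𝔄 ε₄ (εC := εC) hL
    have hsol := (bgSchemeOfRecord_sol_spec F 2 K k Ω U₀ levB Gp Δ2 a hposπ hposb hQ dom R hJ h𝔄).1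
    have hA : ‖(bgSchemeOfRecord F 2 K k Ω U₀ dom levB Gp Δ2 a hposπ hposb hQ εC B₀ C₄ a₃ j a𝔄 ε₄).sol V +
        frakAOfRecordAtBg128 F 2 K k Ω U₀ levB Gp Δ2 a hposπ hQ V‖ < ρ₂ :=
      lt_of_lt_of_le (lt_of_le_of_lt (norm_add_le _ _) (by linarith)) (hfit.trans (min_le_right _ _))
    have hn := lt_of_lt_of_le hA hρ₂aC
    have hSU := expoLinAt_sol_memFlat_of_rows F k Ω U₀ levB a hposb hQ RC hCreal hCtr Gp Δ2 hposπ dom B₀ C₄ a₃ j a𝔄 ε₄ h hA'herm hA'tr hn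
    have hcoe := coeField_chartLinFlat_eq_expOver F 2 K k Ω U₀ levB a hposb hQ Gp Δ2 hposπ dom V _ hSU
    rw [BgScheme.chartLin_sol] at hcoe
    exact hcls _ hA _ hcoe
  · -- the average conjunct
    exact havg₁ dom Gp Δ2 hposπ B₀ C₄ a₃ j a𝔄 ε₄ (hfit.trans (min_le_left _ _)) ha₃ hGpR hGpS hΔ2R hΔ2S R hJ h𝔊 hV h𝔄

end Two

end Summit.QuantumFields.YangMills.Theorems.N07ChartLinFlatBgReg

end
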